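import Mathlib
import Summits.BirchSwinnertonDyer.BirchSwinnertonDyer.Theorems.KatoDescentTamePotSupersingularTameLowerFibreAdjointBricksFive
import Summits.BirchSwinnertonDyer.BirchSwinnertonDyer.Theorems.KatoDescentTamePotSupersingularTameLowerFibreAdjointBricksFiveSmu

/-!
# Bricks for the `GL₂(𝔽₅)`-lifting route (T5′), IX: the ABSTRACT principal small layer of (P′),
# `W`-injective case, at every level

Continuation of `…TameLowerFibreAdjointBricksFive*` (same namespace). ARM-P audit r07 S7 ADD-1 §C proves
(T5′) («a closed `G ≤ GL₂(A)` with residual image `GL₂(𝔽₅)` contains a conjugate of `SL₂(W_A)`») through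
the Artinian kernel (P′), one small surjection `A → B` at a time; ADD-9 (INFO I-S7-8) names as the next
kernel piece «(P′), W-injective case, r = 1, k′ = 𝔽₅, ANY level»: file VIII's argument (`𝔽₅[ε] → 𝔽₅`) with
the dual numbers replaced by an abstract small extension and `H¹(GL₂(𝔽₅), 𝔰𝔩₂) = 0` replaced by file IV's
`H¹(S^μ(ℤ/5^{m+1}), 𝔰𝔩₂(𝔽₅)) = 0`. This file is that piece. SETTING (hypotheses, no definitions): `A` of
characteristic `5^{m+1}` with a residue map `res : A → 𝔽₅` and an element `t`, `res t = 0`, whose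
annihilator is exactly `ker res` (so `tA ≅ 𝔽₅`, `t² = 0`); `π : A → B` with kernel `tA`, `B` of the SAME
characteristic (`W_A = ℤ/5^{m+1} ≅ W_B`); `H ≤ GL₂(A)` with `(det h)⁴ = 1` on `H` (`S^μ` currency) such that
`π(H)` covers the image of `S^μ(ℤ/5^{m+1}) = {(det)⁴ = 1}` in `GL₂(B)`.
`exists_conj_smu_le_of_smallLayer`: **then `u · S^μ(ℤ/5^{m+1}) · u⁻¹ ⊆ H` for some `u` with `π(u) = 1`**
((P′) of ADD-1 §C (C0), `W`-injective, `r = 1`, `k′ = 𝔽₅`, any level; = HOME/k8t-c2/g15 memo §3 (β), CASE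
`W_A ≅ W_B`): the kernel of `GL₂(π)` is `{1 + t·X̃}`, on which `H` acts through `res` by `Ad`;
`N̄ = {X : 1 + tX̃ ∈ H}` is trace-free (`det⁴ = 1`, `μ₄ ∩ (1 + tA) = 1`) and `Ad`-stable, hence `0` or `𝔰𝔩₂`
([M] Lemma 3.3 = file I); if `𝔰𝔩₂`, `u = 1`; if `0`, the `t`-parts of the chosen lifts form an honest
`𝔰𝔩₂(𝔽₅)`-valued cocycle on `S^μ(ℤ/5^{m+1})`, a coboundary by file IV, and `u = 1 − t·x̃`. Instances in Δ1
proper (`𝒪_𝔭/𝔭^{n+1} → 𝒪_𝔭/𝔭ⁿ`, `f = 1`, `e ∤ n`, `t = ϖⁿ`; ADD-9 (A3)(iii)): all of them. Route-free, no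
definitions, nothing about elliptic curves or items 19618/19981 (open). Target T-S7r07-1 (`FibreLatticeInput 5`).
-/

set_option linter.dupNamespace false

open Matrix

namespace Summit.BirchSwinnertonDyer.BirchSwinnertonDyer.Theorems.GL2F5AdjointBricks

section smallcalc

variable {A : Type*} [CommRing A]

/-- `(t•X)(t•Y) = 0` when `t² = 0`. -/
theorem smul_mul_smul_eq_zero_of_mul_self_eq_zero {t : A} (ht : t * t = 0)
    (X Y : Matrix (Fin 2) (Fin 2) A) : (t • X) * (t • Y) = 0 := by
  rw [smul_mul_smul_comm, ht, zero_smul]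

/-- `(1 + t•X)(1 + t•Y) = 1 + t•(X + Y)` when `t² = 0`: the kernel of reduction modulo a square-zero
principal ideal is an additive copy of the matrices. -/
theorem one_add_smul_mul_one_add_smul {t : A} (ht : t * t = 0) (X Y : Matrix (Fin 2) (Fin 2) A) :
    (1 + t • X) * (1 + t • Y) = 1 + t • (X + Y) := by
  rw [add_mul, one_mul, mul_add, mul_one, smul_mul_smul_eq_zero_of_mul_self_eq_zero ht, add_zero, smul_add]
  abel

/-- `(1 + t•X)(1 − t•X) = 1` when `t² = 0`. -/
theorem one_add_smul_mul_one_sub_smul {t : A} (ht : t * t = 0) (X : Matrix (Fin 2) (Fin 2) A) :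
    (1 + t • X) * (1 - t • X) = 1 := by
  rw [sub_eq_add_neg, ← smul_neg, one_add_smul_mul_one_add_smul ht, add_neg_cancel, smul_zero, add_zero]

/-- `(1 − t•X)(1 + t•X) = 1` when `t² = 0`. -/
theorem one_sub_smul_mul_one_add_smul {t : A} (ht : t * t = 0) (X : Matrix (Fin 2) (Fin 2) A) :
    (1 - t • X) * (1 + t • X) = 1 := by
  rw [sub_eq_add_neg, ← smul_neg, one_add_smul_mul_one_add_smul ht, neg_add_cancel, smul_zero, add_zero]

/-- Conjugation of a kernel element: `P (1 + t•X) Q = 1 + t•(P X Q)` when `P Q = 1`. -/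
theorem mul_one_add_smul_mul (t : A) (P Q X : Matrix (Fin 2) (Fin 2) A) (hPQ : P * Q = 1) :
    P * (1 + t • X) * Q = 1 + t • (P * X * Q) := by
  rw [mul_add, mul_one, add_mul, hPQ, Matrix.mul_smul, Matrix.smul_mul]

/-- `det (1 + t•M) = 1 + t·tr M` for a `2 × 2` matrix when `t² = 0`. -/
theorem det_one_add_smul {t : A} (ht : t * t = 0) (M : Matrix (Fin 2) (Fin 2) A) :
    Matrix.det (1 + t • M) = 1 + t * (M 0 0 + M 1 1) := by
  rw [Matrix.det_fin_two]
  simp only [Matrix.add_apply, Matrix.one_apply_eq, Matrix.smul_apply, smul_eq_mul, ne_eq, zero_ne_one,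
    not_false_eq_true, Matrix.one_apply_ne, one_ne_zero, zero_add]
  linear_combination (M 0 0 * M 1 1 - M 0 1 * M 1 0) * ht

/-- `(1 + t·s)⁴ = 1 + 4·t·s` when `t² = 0`. -/
theorem one_add_mul_pow_four {t : A} (ht : t * t = 0) (s : A) :
    (1 + t * s) ^ 4 = 1 + 4 * (t * s) := by
  linear_combination (6 * s ^ 2 + 4 * t * s ^ 3 + t ^ 2 * s ^ 4) * ht

/-- **Residue transport.** If `t` kills `ker res`, then `t • M = t • X̃` where `X̃` is the canonical lift
of `M mod res`: the `t`-multiples of matrices over `A` are an `𝔽₅`-structure through `res`. -/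
theorem smul_eq_smul_map_val {res : A →+* ZMod 5} {t : A} (htm : ∀ a, res a = 0 → t * a = 0)
    (M : Matrix (Fin 2) (Fin 2) A) :
    t • M = t • (M.map res).map (fun x : ZMod 5 => ((x.val : ℕ) : A)) := by
  ext i j
  simp only [Matrix.smul_apply, Matrix.map_apply, smul_eq_mul]
  have h : res (M i j - (((res (M i j)).val : ℕ) : A)) = 0 := by
    rw [map_sub, map_natCast, ZMod.natCast_zmod_val, sub_self]
  have h2 := htm _ h
  rw [mul_sub, sub_eq_zero] at h2
  exact h2

/-- The canonical lift reduces back: `res ∘ (x ↦ x.val) = id` entrywise. -/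
theorem map_map_val_res (res : A →+* ZMod 5) (X : Matrix (Fin 2) (Fin 2) (ZMod 5)) :
    (X.map (fun x : ZMod 5 => ((x.val : ℕ) : A))).map res = X := by
  ext i j
  simp only [Matrix.map_apply, map_natCast, ZMod.natCast_zmod_val]

end smallcalc

section smalllayer

variable {A B : Type*} [CommRing A] [CommRing B]

/-- **The abstract principal small layer of (P′), `W`-injective case, every level (ARM-P r07 S7 ADD-1 §C
(C0)/(C3); ADD-9 INFO I-S7-8 (1)).** Let `A` have characteristic `5^{m+1}`, a residue map `res : A → 𝔽₅`
and an element `t` with `res t = 0` and `ann(t) = ker res`; let `π : A → B` have kernel `tA`, with `B` also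
of characteristic `5^{m+1}`. If `H ≤ GL₂(A)` has `(det h)⁴ = 1` on `H` and `π(H)` covers the image of
`S^μ(ℤ/5^{m+1})` in `GL₂(B)`, then `u · S^μ(ℤ/5^{m+1}) · u⁻¹ ⊆ H` for some `u ∈ GL₂(A)` with `π(u) = 1`
— in particular `H` contains a conjugate of `SL₂(ℤ/5^{m+1})`. -/
theorem exists_conj_smu_le_of_smallLayer (m : ℕ) [CharP A (5 ^ (m + 1))] [CharP B (5 ^ (m + 1))]
    (π : A →+* B) (res : A →+* ZMod 5) (t : A) (ht : res t = 0)
    (hann : ∀ a, t * a = 0 ↔ res a = 0) (hker : ∀ a, π a = 0 ↔ ∃ x, a = t * x)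
    (H : Subgroup (GL (Fin 2) A))
    (hHμ : ∀ h ∈ H, Matrix.det (h : Matrix (Fin 2) (Fin 2) A) ^ 4 = 1)
    (hcover : ∀ g : GL (Fin 2) (ZMod (5 ^ (m + 1))),
      Matrix.det (g : Matrix (Fin 2) (Fin 2) (ZMod (5 ^ (m + 1)))) ^ 4 = 1 →
        ∃ h ∈ H, Matrix.GeneralLinearGroup.map π h =
          Matrix.GeneralLinearGroup.map (ZMod.castHom (dvd_refl (5 ^ (m + 1))) B) g) :
    ∃ u : GL (Fin 2) A, Matrix.GeneralLinearGroup.map π u = 1 ∧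
      ∀ g : GL (Fin 2) (ZMod (5 ^ (m + 1))),
        Matrix.det (g : Matrix (Fin 2) (Fin 2) (ZMod (5 ^ (m + 1)))) ^ 4 = 1 →
          u * Matrix.GeneralLinearGroup.map (ZMod.castHom (dvd_refl (5 ^ (m + 1))) A) g * u⁻¹ ∈ H := by
  classical
  have h25 : (2 : ZMod 5) ≠ 0 := by decide
  have h45 : (4 : ZMod 5) ≠ 0 := by decide
  haveI : NeZero (5 ^ (m + 1)) := ⟨pow_ne_zero _ (by norm_num)⟩
  haveI : Fact (Nat.Prime 5) := ⟨by norm_num⟩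
  -- basic consequences of the setting
  have htt : t * t = 0 := (hann t).2 ht
  have htm : ∀ a, res a = 0 → t * a = 0 := fun a ha => (hann a).2 ha
  have hπt : π t = 0 := (hker t).2 ⟨1, (mul_one t).symm⟩
  -- notation: reductions and the structure maps of `W = ℤ/5^{m+1}`
  set c5 := ZMod.castHom (dvd_pow_self 5 (Nat.succ_ne_zero m)) (ZMod 5) with hc5
  set red := Matrix.GeneralLinearGroup.map (n := Fin 2) c5 with hred
  set ιA := Matrix.GeneralLinearGroup.map (n := Fin 2) (ZMod.castHom (dvd_refl (5 ^ (m + 1))) A) with hιA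
  set ιB := Matrix.GeneralLinearGroup.map (n := Fin 2) (ZMod.castHom (dvd_refl (5 ^ (m + 1))) B) with hιB
  set πG := Matrix.GeneralLinearGroup.map (n := Fin 2) π with hπG
  set ρ := Matrix.GeneralLinearGroup.map (n := Fin 2) res with hρ
  have hπι : ∀ g, πG (ιA g) = ιB g := by
    intro g
    have hc : π.comp (ZMod.castHom (dvd_refl (5 ^ (m + 1))) A) = ZMod.castHom (dvd_refl (5 ^ (m + 1))) B :=
      Subsingleton.elim _ _
    have h : Matrix.GeneralLinearGroup.map (n := Fin 2) (π.comp (ZMod.castHom (dvd_refl (5 ^ (m + 1))) A)) g =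
        ιB g := by rw [hc]
    rw [Matrix.GeneralLinearGroup.map_comp] at h
    exact h
  have hρι : ∀ g, ρ (ιA g) = red g := by
    intro g
    have hc : res.comp (ZMod.castHom (dvd_refl (5 ^ (m + 1))) A) = c5 := Subsingleton.elim _ _
    have h : Matrix.GeneralLinearGroup.map (n := Fin 2) (res.comp (ZMod.castHom (dvd_refl (5 ^ (m + 1))) A)) g =
        red g := by rw [hc]
    rw [Matrix.GeneralLinearGroup.map_comp] at h
    exact h
  have hρval : ∀ h : GL (Fin 2) A, (ρ h).val = (h.val).map res := fun h => rfl
  have hπGval : ∀ h : GL (Fin 2) A, (πG h).val = (h.val).map π := fun h => rfl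
  -- the lift `L` and the kernel elements `τ X = 1 + t • L X`
  let L : Matrix (Fin 2) (Fin 2) (ZMod 5) → Matrix (Fin 2) (Fin 2) A := fun X =>
    X.map (fun x : ZMod 5 => ((x.val : ℕ) : A))
  have hLres : ∀ X, (L X).map res = X := fun X => map_map_val_res res X
  have htL : ∀ M : Matrix (Fin 2) (Fin 2) A, t • M = t • L (M.map res) := fun M => smul_eq_smul_map_val htm M
  let τ : Matrix (Fin 2) (Fin 2) (ZMod 5) → GL (Fin 2) A := fun X =>
    ⟨1 + t • L X, 1 - t • L X, one_add_smul_mul_one_sub_smul htt (L X), one_sub_smul_mul_one_add_smul htt (L X)⟩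
  have hτval : ∀ X, (τ X).val = 1 + t • L X := fun X => rfl
  have hτadd : ∀ X Y, τ (X + Y) = τ X * τ Y := by
    intro X Y; apply Units.ext
    rw [Units.val_mul, hτval, hτval, hτval, one_add_smul_mul_one_add_smul htt, htL (L X + L Y), Matrix.map_add,
      hLres, hLres]
    exact fun a b => map_add res a b
  have hτzero : τ 0 = 1 := by
    apply Units.ext; rw [hτval, Units.val_one]
    have : L 0 = 0 := by ext i j; simp [L]
    rw [this, smul_zero, add_zero]
  have hτneg : ∀ X, τ (-X) = (τ X)⁻¹ := by
    intro X; apply eq_inv_of_mul_eq_one_left; rw [← hτadd, neg_add_cancel, hτzero]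
  have hτsub : ∀ X Y, τ (X - Y) = τ X * (τ Y)⁻¹ := by
    intro X Y; rw [sub_eq_add_neg, hτadd, hτneg]
  have hπτ : ∀ X, πG (τ X) = 1 := by
    intro X; apply Units.ext; rw [hπGval, hτval, Units.val_one]
    ext i j
    simp only [Matrix.map_apply, Matrix.add_apply, Matrix.smul_apply, smul_eq_mul, map_add, map_mul, hπt,
      zero_mul, add_zero, Matrix.one_apply]
    split_ifs <;> simp
  have hρτ : ∀ X, ρ (τ X) = 1 := by
    intro X; apply Units.ext; rw [hρval, hτval, Units.val_one]
    ext i j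
    simp only [Matrix.map_apply, Matrix.add_apply, Matrix.smul_apply, smul_eq_mul, map_add, map_mul, ht,
      zero_mul, add_zero, Matrix.one_apply]
    split_ifs <;> simp
  -- conjugation acts through `ρ`
  have hconj : ∀ (h : GL (Fin 2) A) (X : Matrix (Fin 2) (Fin 2) (ZMod 5)),
      h * τ X * h⁻¹ = τ ((ρ h).val * X * ((ρ h)⁻¹).val) := by
    intro h X
    apply Units.ext
    rw [Units.val_mul, Units.val_mul, hτval, hτval,
      mul_one_add_smul_mul t _ _ (L X) (by rw [← Units.val_mul, mul_inv_cancel, Units.val_one]),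
      htL (h.val * L X * (h⁻¹).val)]
    congr 2
    rw [Matrix.map_mul, Matrix.map_mul, hLres, ← map_inv, hρval, hρval]
  -- the kernel of `πG` consists of the `τ X`
  have hK : ∀ k : GL (Fin 2) A, πG k = 1 → ∃ X, k = τ X := by
    intro k hk
    have hent : ∀ i j, ∃ x : A, (k.val - 1) i j = t * x := by
      intro i j
      apply (hker _).1
      have h := congrArg (fun g : GL (Fin 2) B => g.val i j) hk
      simp only [hπGval, Matrix.map_apply, Units.val_one] at h
      rw [Matrix.sub_apply, map_sub, h, Matrix.one_apply, Matrix.one_apply]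
      split_ifs <;> simp
    choose x hx using hent
    refine ⟨(Matrix.of fun i j => x i j).map res, Units.ext ?_⟩
    rw [hτval, ← htL]
    ext i j
    have h := hx i j
    rw [Matrix.sub_apply, sub_eq_iff_eq_add'] at h
    rw [h, Matrix.add_apply, Matrix.smul_apply, Matrix.of_apply, smul_eq_mul]
  -- `det⁴ = 1` forces trace zero on kernel elements
  have htr_of_det : ∀ X, Matrix.det ((τ X).val) ^ 4 = 1 → Matrix.trace X = 0 := by
    intro X hX
    rw [hτval, det_one_add_smul htt, one_add_mul_pow_four htt, add_eq_left, ← mul_assoc,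
      mul_comm (4 : A) t, mul_assoc, hann, map_mul, map_add] at hX
    have h4 : (res 4 : ZMod 5) = 4 := map_ofNat res 4
    rw [h4] at hX
    have hLr : ∀ i, res (L X i i) = X i i := fun i => by
      have := congrArg (fun M : Matrix (Fin 2) (Fin 2) (ZMod 5) => M i i) (hLres X)
      simpa only [Matrix.map_apply] using this
    rw [hLr, hLr] at hX
    rw [Matrix.trace_fin_two]
    rcases mul_eq_zero.1 hX with h | h
    · exact absurd h h45
    · exact h
  -- determinants of `ιA g`
  have hdetι : ∀ g : GL (Fin 2) (ZMod (5 ^ (m + 1))),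
      Matrix.det (g : Matrix (Fin 2) (Fin 2) (ZMod (5 ^ (m + 1)))) ^ 4 = 1 →
        Matrix.det ((ιA g).val) ^ 4 = 1 := by
    intro g hg
    have hd : Matrix.det ((ιA g).val) = ZMod.castHom (dvd_refl (5 ^ (m + 1))) A
        (Matrix.det (g : Matrix (Fin 2) (Fin 2) (ZMod (5 ^ (m + 1))))) := by
      rw [RingHom.map_det]; rfl
    rw [hd, ← map_pow, hg, map_one]
  have hdet_mul : ∀ a b : GL (Fin 2) A, Matrix.det ((a * b).val) = Matrix.det a.val * Matrix.det b.val := by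
    intro a b; rw [Units.val_mul, Matrix.det_mul]
  have hdet_inv : ∀ a : GL (Fin 2) A, Matrix.det a.val ^ 4 = 1 → Matrix.det (a⁻¹).val ^ 4 = 1 := by
    intro a ha
    have h1 : Matrix.det a.val * Matrix.det (a⁻¹).val = 1 := by
      rw [← Matrix.det_mul, ← Units.val_mul, mul_inv_cancel, Units.val_one, Matrix.det_one]
    have h2 := congrArg (· ^ 4) h1
    simp only [mul_pow, ha, one_mul, one_pow] at h2
    exact h2
  -- chosen lifts `s g ∈ H` over `ιB g` (for `g ∈ S^μ`), written `s g = τ (c g) * ιA g`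
  have hcover' : ∀ g : GL (Fin 2) (ZMod (5 ^ (m + 1))), ∃ h : GL (Fin 2) A,
      Matrix.det (g : Matrix (Fin 2) (Fin 2) (ZMod (5 ^ (m + 1)))) ^ 4 = 1 → h ∈ H ∧ πG h = ιB g := by
    intro g
    by_cases hg : Matrix.det (g : Matrix (Fin 2) (Fin 2) (ZMod (5 ^ (m + 1)))) ^ 4 = 1
    · obtain ⟨h, hH, hh⟩ := hcover g hg; exact ⟨h, fun _ => ⟨hH, hh⟩⟩
    · exact ⟨1, fun h => absurd h hg⟩
  choose s hs using hcover'
  have hsc' : ∀ g : GL (Fin 2) (ZMod (5 ^ (m + 1))),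
      Matrix.det (g : Matrix (Fin 2) (Fin 2) (ZMod (5 ^ (m + 1)))) ^ 4 = 1 → ∃ X, s g = τ X * ιA g := by
    intro g hg
    have hk : πG (s g * (ιA g)⁻¹) = 1 := by rw [map_mul, map_inv, (hs g hg).2, hπι, mul_inv_cancel]
    obtain ⟨X, hX⟩ := hK _ hk
    exact ⟨X, by rw [← hX, inv_mul_cancel_right]⟩
  have hc_ex : ∀ g : GL (Fin 2) (ZMod (5 ^ (m + 1))), ∃ X : Matrix (Fin 2) (Fin 2) (ZMod 5),
      Matrix.det (g : Matrix (Fin 2) (Fin 2) (ZMod (5 ^ (m + 1)))) ^ 4 = 1 → s g = τ X * ιA g := by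
    intro g
    by_cases hg : Matrix.det (g : Matrix (Fin 2) (Fin 2) (ZMod (5 ^ (m + 1)))) ^ 4 = 1
    · obtain ⟨X, hX⟩ := hsc' g hg; exact ⟨X, fun _ => hX⟩
    · exact ⟨0, fun h => absurd h hg⟩
  choose c hc using hc_ex
  -- the subspace `N̄ = {X : τ X ∈ H}`; it is trace-free and `Ad`-stable
  let Nbar : Submodule (ZMod 5) (Matrix (Fin 2) (Fin 2) (ZMod 5)) :=
    { carrier := {X | τ X ∈ H}
      add_mem' := by
        intro X X' hX hX'
        show τ (X + X') ∈ H
        rw [hτadd]; exact H.mul_mem hX hX'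
      zero_mem' := by show τ 0 ∈ H; rw [hτzero]; exact H.one_mem
      smul_mem' := by
        intro a X hX
        show τ (a • X) ∈ H
        have ha : a • X = a.val • X := by
          rw [← ZMod.natCast_zmod_val a, Nat.cast_smul_eq_nsmul]; simp
        rw [ha]
        induction a.val with
        | zero => rw [zero_smul, hτzero]; exact H.one_mem
        | succ n ih => rw [succ_nsmul, hτadd]; exact H.mul_mem ih hX }
  have hNmem : ∀ X, X ∈ Nbar ↔ τ X ∈ H := fun X => Iff.rfl
  have hNtr : ∀ X ∈ Nbar, Matrix.trace X = 0 := fun X hX => htr_of_det X (hHμ _ ((hNmem X).1 hX))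
  have hNconj : ∀ h ∈ H, ∀ X ∈ Nbar, (ρ h).val * X * ((ρ h)⁻¹).val ∈ Nbar := by
    intro h hh X hX
    rw [hNmem] at hX ⊢
    rw [← hconj h X]; exact H.mul_mem (H.mul_mem hh hX) (H.inv_mem hh)
  -- the transvections, as elements of `S^μ(ℤ/5^{m+1})`, give `Ad u`, `Ad v` on `N̄`
  let uW : GL (Fin 2) (ZMod (5 ^ (m + 1))) :=
    ⟨!![1, 1; 0, 1], !![1, -1; 0, 1], by rw [Matrix.mul_fin_two, Matrix.one_fin_two]; simp,
      by rw [Matrix.mul_fin_two, Matrix.one_fin_two]; simp⟩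
  let vW : GL (Fin 2) (ZMod (5 ^ (m + 1))) :=
    ⟨!![1, 0; 1, 1], !![1, 0; -1, 1], by rw [Matrix.mul_fin_two, Matrix.one_fin_two]; simp,
      by rw [Matrix.mul_fin_two, Matrix.one_fin_two]; simp⟩
  have huWval : uW.val = !![1, 1; 0, 1] := rfl
  have huWinv : (uW⁻¹).val = !![1, -1; 0, 1] := rfl
  have hvWval : vW.val = !![1, 0; 1, 1] := rfl
  have hvWinv : (vW⁻¹).val = !![1, 0; -1, 1] := rfl
  have hredval : ∀ g : GL (Fin 2) (ZMod (5 ^ (m + 1))), (red g).val = (g.val).map c5 := fun g => rfl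
  have huWdet : Matrix.det (uW : Matrix (Fin 2) (Fin 2) (ZMod (5 ^ (m + 1)))) ^ 4 = 1 := by
    rw [huWval, Matrix.det_fin_two_of]; ring
  have hvWdet : Matrix.det (vW : Matrix (Fin 2) (Fin 2) (ZMod (5 ^ (m + 1)))) ^ 4 = 1 := by
    rw [hvWval, Matrix.det_fin_two_of]; ring
  have hred_u : (red uW).val = !![1, 1; 0, 1] := by
    rw [hredval, huWval]
    ext i j; fin_cases i <;> fin_cases j <;> simp
  have hred_u' : ((red uW)⁻¹).val = !![1, -1; 0, 1] := by
    rw [← map_inv, hredval, huWinv]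
    ext i j; fin_cases i <;> fin_cases j <;> simp
  have hred_v : (red vW).val = !![1, 0; 1, 1] := by
    rw [hredval, hvWval]
    ext i j; fin_cases i <;> fin_cases j <;> simp
  have hred_v' : ((red vW)⁻¹).val = !![1, 0; -1, 1] := by
    rw [← map_inv, hredval, hvWinv]
    ext i j; fin_cases i <;> fin_cases j <;> simp
  have hρs : ∀ g : GL (Fin 2) (ZMod (5 ^ (m + 1))), Matrix.det (g : Matrix (Fin 2) (Fin 2) (ZMod (5 ^ (m + 1)))) ^ 4 = 1 → ρ (s g) = red g := by
    intro g hg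
    rw [hc g hg, map_mul, hρτ, one_mul, hρι]
  have hNu : ∀ X ∈ Nbar, !![1, 1; 0, 1] * X * !![1, -1; 0, 1] ∈ Nbar := by
    intro X hX
    have h := hNconj (s uW) (hs uW huWdet).1 X hX
    rwa [hρs uW huWdet, hred_u, hred_u'] at h
  have hNv : ∀ X ∈ Nbar, !![1, 0; 1, 1] * X * !![1, 0; -1, 1] ∈ Nbar := by
    intro X hX
    have h := hNconj (s vW) (hs vW hvWdet).1 X hX
    rwa [hρs vW hvWdet, hred_v, hred_v'] at h
  have dich := traceless_submodule_eq_bot_or_top (F := ZMod 5) h25 Nbar hNtr hNu hNv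
  -- the `t`-parts `c g` are trace-free and satisfy the cocycle identity modulo `N̄`
  have hc_tr : ∀ g : GL (Fin 2) (ZMod (5 ^ (m + 1))), Matrix.det (g : Matrix (Fin 2) (Fin 2) (ZMod (5 ^ (m + 1)))) ^ 4 = 1 →
      Matrix.trace (c g) = 0 := by
    intro g hg
    apply htr_of_det
    have h1 : Matrix.det ((s g).val) ^ 4 = 1 := hHμ _ (hs g hg).1
    have h2 : τ (c g) = s g * (ιA g)⁻¹ := by rw [hc g hg, mul_inv_cancel_right]
    rw [h2, hdet_mul, mul_pow, h1, one_mul]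
    exact hdet_inv _ (hdetι g hg)
  have hD : ∀ g g' : GL (Fin 2) (ZMod (5 ^ (m + 1))),
      Matrix.det (g : Matrix (Fin 2) (Fin 2) (ZMod (5 ^ (m + 1)))) ^ 4 = 1 →
      Matrix.det (g' : Matrix (Fin 2) (Fin 2) (ZMod (5 ^ (m + 1)))) ^ 4 = 1 →
        s g * s g' * (s (g * g'))⁻¹ = τ (c g + (red g).val * c g' * ((red g)⁻¹).val - c (g * g')) := by
    intro g g' hg hg'
    have hgg' : Matrix.det ((g * g' : GL (Fin 2) (ZMod (5 ^ (m + 1)))) :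
        Matrix (Fin 2) (Fin 2) (ZMod (5 ^ (m + 1)))) ^ 4 = 1 := by
      rw [Units.val_mul, Matrix.det_mul, mul_pow, hg, hg', one_mul]
    have h1 : ιA g * τ (c g') = τ ((red g).val * c g' * ((red g)⁻¹).val) * ιA g := by
      have h := hconj (ιA g) (c g'); rw [hρι] at h
      rw [← h, inv_mul_cancel_right]
    rw [hc g hg, hc g' hg', hc (g * g') hgg', map_mul, hτsub, hτadd]
    calc τ (c g) * ιA g * (τ (c g') * ιA g') * (τ (c (g * g')) * (ιA g * ιA g'))⁻¹
        = τ (c g) * (ιA g * τ (c g')) * ιA g' * (ιA g * ιA g')⁻¹ * (τ (c (g * g')))⁻¹ := by group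
      _ = τ (c g) * (τ ((red g).val * c g' * ((red g)⁻¹).val) * ιA g) * ιA g' * (ιA g * ιA g')⁻¹ *
            (τ (c (g * g')))⁻¹ := by rw [h1]
      _ = τ (c g) * τ ((red g).val * c g' * ((red g)⁻¹).val) * (τ (c (g * g')))⁻¹ := by group
  have hδ : ∀ g g' : GL (Fin 2) (ZMod (5 ^ (m + 1))),
      Matrix.det (g : Matrix (Fin 2) (Fin 2) (ZMod (5 ^ (m + 1)))) ^ 4 = 1 →
      Matrix.det (g' : Matrix (Fin 2) (Fin 2) (ZMod (5 ^ (m + 1)))) ^ 4 = 1 →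
        c g + (red g).val * c g' * ((red g)⁻¹).val - c (g * g') ∈ Nbar := by
    intro g g' hg hg'
    have hgg' : Matrix.det ((g * g' : GL (Fin 2) (ZMod (5 ^ (m + 1)))) :
        Matrix (Fin 2) (Fin 2) (ZMod (5 ^ (m + 1)))) ^ 4 = 1 := by
      rw [Units.val_mul, Matrix.det_mul, mul_pow, hg, hg', one_mul]
    rw [hNmem, ← hD g g' hg hg']
    exact H.mul_mem (H.mul_mem (hs g hg).1 (hs g' hg').1) (H.inv_mem (hs _ hgg').1)
  -- conclusion
  rcases dich with hbot | htop
  · -- `N̄ = 0`: `c` is an honest trace-free cocycle on `S^μ(ℤ/5^{m+1})`, hence a coboundary (file IV)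
    have hcoc : ∀ g g' : GL (Fin 2) (ZMod (5 ^ (m + 1))),
        Matrix.det (g : Matrix (Fin 2) (Fin 2) (ZMod (5 ^ (m + 1)))) ^ 4 = 1 →
        Matrix.det (g' : Matrix (Fin 2) (Fin 2) (ZMod (5 ^ (m + 1)))) ^ 4 = 1 →
          c (g * g') = c g + (red g).val * c g' * ((red g)⁻¹).val := by
      intro g g' hg hg'
      have h := hδ g g' hg hg'
      rw [hbot] at h
      exact (sub_eq_zero.1 ((Submodule.mem_bot (R := ZMod 5)).1 h)).symm
    obtain ⟨x, -, hx⟩ := smu_exists_traceless_eq_coboundary m c hc_tr hcoc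
    refine ⟨τ (-x), hπτ _, fun g hg => ?_⟩
    have h1 : ιA g * τ x = τ ((red g).val * x * ((red g)⁻¹).val) * ιA g := by
      have h := hconj (ιA g) x; rw [hρι] at h
      rw [← h, inv_mul_cancel_right]
    have hkey : τ (-x) * ιA g * (τ (-x))⁻¹ = s g := by
      rw [hc g hg, hx g hg, ← hτneg, neg_neg, mul_assoc, h1, ← mul_assoc, ← hτadd,
        show -x + (red g).val * x * ((red g)⁻¹).val = (red g).val * x * ((red g)⁻¹).val - x by abel]
    rw [hkey]; exact (hs g hg).1
  · -- `N̄ = 𝔰𝔩₂`: `τ (c g) ∈ H`, so `ιA g ∈ H`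
    refine ⟨1, map_one πG, fun g hg => ?_⟩
    rw [one_mul, inv_one, mul_one]
    have hτc : τ (c g) ∈ H := (hNmem _).1 (htop (c g) (hc_tr g hg))
    have hq : ιA g = (τ (c g))⁻¹ * s g := by rw [hc g hg, inv_mul_cancel_left]
    rw [hq]; exact H.mul_mem (H.inv_mem hτc) (hs g hg).1

end smalllayer

end Summit.BirchSwinnertonDyer.BirchSwinnertonDyer.Theorems.GL2F5AdjointBricks
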